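import Summits.FinalStateConjecture.FinalStateConjecture.Theorems.PhotonSphereChannelsChannelsResolveTameDevelopmentsRDarkFutureReduction
import Summits.FinalStateConjecture.FinalStateConjecture.Theorems.PhotonSphereChannelsChannelsResolveTameDevelopmentsRFlatHullElement
import Summits.FinalStateConjecture.FinalStateConjecture.Theorems.PhotonSphereChannelsChannelsResolveTameDevelopmentsRMinkowskiMaximal
import Literature.Geometry.Lorentzian.CauchyProblemProofs
import Literature.Geometry.Lorentzian.MinkowskiGlobalHyperbolicity
import HarnessLib

/-!
# Route PhotonSphereChannels · crux `ChannelsResolveTameDevelopmentsR` (K2R-T2, stmt-FinalStateConjecture-17430) ·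
# line `tame-lasalle-dock` · stub D `stub_dockReadyHull`: the FLAT silent hull element is DOCK-READY
# (anti-vacuity certificate of stub D at the one certified development)

Stub D (`stub_dockReadyHull`, Reshape 1 of lead c8) asserts for every silent hull element `(𝓢, E, p)` of a development
as in Φ: (G6) `IsMinkowski 𝓢 → E.horizon = ∅`, and (case B) `𝓢` globally hyperbolic and timelike- and null-geodesically
complete OR (case A) a globally hyperbolic black-hole-or-complete REPRESENTATIVE. This file checks the statement at the
flat branch, where everything is certified in the tree:

* `dockReadyHull_conclusion_flatEnd` — the conclusion of stub D VERBATIM at `𝓢 = Minkowski.spacetime`, `E` = the flat end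
  `EndDatum.mk 0 1 0 Subtype.val (fun x ↦ x 0)` (any base point): (G6) by `FlatEnd.horizon_flatEnd`, case B by
  `Minkowski.isGloballyHyperbolic` and `minkowski_isGeodesicallyComplete_holds`;
* `isSilentHullElement_flatEnd` — that `(𝓢, E, 0)` IS a silent hull element of the Minkowski vacuum Cauchy development
  along the time axis, in every all-orders class with `1 ≤ Λ 0`, `0 < r₀` (the hypothesis of stub D is inhabited there);
* `dockReadyHull_flat_certificate` (registered sub-goal) — both at once, under `DevHyp` of the Minkowski development
  given the Choquet-Bruhat–Geroch fact (`ChannelsResolveTameDevelopmentsR.TrivialDatum.minkowski_devHyp`): stub D is non-vacuous and holds at the model.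

No route item is restated; the conclusion of D is written out, its hypothesis instantiated.

References: Anderson 2004, Def. 1.1 [Anderson2004]; Hawking–Ellis 1973, §6.6 and Prop. 6.6.3 [HawkingEllis1973CUP];
O'Neill 1983, Ch. 3, Example 3.25 [ONeill1983]; Wald 1984, §12.1 [Wald1984].
-/

noncomputable section

set_option maxSynthPendingDepth 3
set_option linter.dupNamespace false

open Set Filter Function TopologicalSpace Manifold Bundle
open scoped Topology Manifold ContDiff ENNReal NNReal

namespace Summit.FinalStateConjecture.FinalStateConjecture.Theorems.TameLaSalle

open Literature.Geometry.Lorentzian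
open Summit.FinalStateConjecture.FinalStateConjecture.Theorems.TameHull
open Summit.FinalStateConjecture.FinalStateConjecture.Theorems.DarkFuture

/-- **Minkowski spacetime is timelike- and null-geodesically complete** (its Levi-Civita geodesics are the affinely
parametrised straight lines, `minkowski_isGeodesicallyComplete_holds`; a geodesically complete connection is causal
geodesically complete). O'Neill 1983, Ch. 3, Example 3.25. [cite: ONeill1983, Ch. 3, Example 3.25] -/
theorem isTimelikeGeodesicallyComplete_and_isNullGeodesicallyComplete_minkowski
    [Minkowski.spacetime.metric.HasLeviCivita] :
    Minkowski.spacetime.metric.IsTimelikeGeodesicallyComplete ∧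
      Minkowski.spacetime.metric.IsNullGeodesicallyComplete :=
  (LorentzianMetric.isCausalGeodesicallyComplete_iff Minkowski.spacetime.metric).1
    (LorentzianMetric.isCausalGeodesicallyComplete_of_isGeodesicallyComplete Minkowski.spacetime.metric
      minkowski_isGeodesicallyComplete_holds)

/-- **The conclusion of stub D holds VERBATIM at the flat end of Minkowski spacetime** (every base point): (G6) the
flat end has empty future event horizon (`FlatEnd.horizon_flatEnd`), and case B — Minkowski spacetime is globally
hyperbolic (`Minkowski.isGloballyHyperbolic`) and timelike- and null-geodesically complete. Hawking–Ellis 1973, §6.6;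
O'Neill 1983, Ch. 3, Example 3.25. [cite: HawkingEllis1973CUP, §6.6 and Prop. 6.6.3] -/
theorem dockReadyHull_conclusion_flatEnd :
    (IsMinkowski Minkowski.spacetime →
      EndDatum.horizon (EndDatum.mk 0 1 0 Subtype.val (fun x : E4 ↦ x 0) : EndDatum Minkowski.spacetime) = ∅) ∧
    ∀ [Minkowski.spacetime.metric.HasLeviCivita],
      (Minkowski.spacetime.metric.IsGloballyHyperbolic Minkowski.spacetime.timeOrientation ∧
          Minkowski.spacetime.metric.IsTimelikeGeodesicallyComplete ∧
          Minkowski.spacetime.metric.IsNullGeodesicallyComplete) ∨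
      (∃ (𝓢' : Spacetime.{0} 4) (E' : EndDatum 𝓢') (Λ' : ℕ → ℝ≥0) (r₀' : ℝ)
          (j : 𝓢'.carrier → Minkowski.spacetime.carrier),
        IsTameClass E' Λ' r₀' ∧ E'.IsSilent ∧
        (∀ [𝓢'.metric.HasLeviCivita], 𝓢'.metric.IsGloballyHyperbolic 𝓢'.timeOrientation ∧
          ((𝓢'.blackHoleRegionOfEnd (Set.range E'.far)).Nonempty ∨
            (𝓢'.metric.IsTimelikeGeodesicallyComplete ∧ 𝓢'.metric.IsNullGeodesicallyComplete))) ∧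
        Function.Injective j ∧
        PseudoRiemannianMetric.IsLocalIsometry 𝓢'.metric.toPseudoRiemannianMetric
          Minkowski.spacetime.metric.toPseudoRiemannianMetric j ∧
        (∀ (x : 𝓢'.carrier) (v : TangentSpace (𝓡 4) x), 𝓢'.timeOrientation.IsFutureDirected v →
          Minkowski.spacetime.timeOrientation.IsFutureDirected (mfderiv (𝓡 4) (𝓡 4) j x v)) ∧
        j '' E'.doc = EndDatum.doc (EndDatum.mk 0 1 0 Subtype.val (fun x : E4 ↦ x 0) : EndDatum Minkowski.spacetime) ∧
        (IsMinkowski 𝓢' → IsMinkowski Minkowski.spacetime)) :=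
  ⟨fun _ ↦ FlatEnd.horizon_flatEnd, fun {_} ↦ Or.inl ⟨Minkowski.isGloballyHyperbolic,
    isTimelikeGeodesicallyComplete_and_isNullGeodesicallyComplete_minkowski⟩⟩

/-- **The flat end along the time axis IS a silent hull element of the Minkowski vacuum Cauchy development** in every
all-orders class `(Λ, r₀)` with `1 ≤ Λ 0`, `0 < r₀`: the time axis `qₙ = (n+1, 0)` is future-escaping
(`FlatEnd.isFutureEscaping_timeAxis_minkowski`), the flat end is in the class (`isTameClass_flatEnd`) and silent
(`FlatEnd.isSilent_flatEnd`), the base point `0` lies in the closure of its d.o.c. (`= ℝ⁴`), and `(ℝ⁴₁, qₙ) ⇀ (ℝ⁴₁, 0)` in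
pointed `C²` (`FlatEnd.subconvergesLocallyTo_minkowski_translates`). So the hypothesis of stub D is inhabited at the
flat branch. Anderson 2004, Def. 1.1. [cite: Anderson2004, Def. 1.1] -/
theorem isSilentHullElement_flatEnd [Minkowski.vacuumCauchyDevelopment.metric.HasLeviCivita] (Λ : ℕ → ℝ≥0)
    (hΛ : 1 ≤ ((Λ 0 : ℝ≥0) : ℝ)) {r₀ : ℝ} (hr₀ : 0 < r₀) :
    IsSilentHullElement Minkowski.vacuumCauchyDevelopment Λ r₀
      (fun n : ℕ ↦ (E4.ofTimeSpace ((n : ℝ) + 1) 0 : E4)) Minkowski.spacetime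
      (EndDatum.mk 0 1 0 Subtype.val (fun x : E4 ↦ x 0) : EndDatum Minkowski.spacetime) (0 : E4) :=
  ⟨FlatEnd.isFutureEscaping_timeAxis_minkowski, isTameClass_flatEnd Λ hΛ hr₀, FlatEnd.isSilent_flatEnd,
    FlatEnd.mem_closure_doc_flatEnd _,
    FlatEnd.subconvergesLocallyTo_minkowski_translates (fun n : ℕ ↦ E4.ofTimeSpace ((n : ℝ) + 1) 0) 2⟩

/-- **Stub D is non-vacuous and holds at the model (registered sub-goal `dockReadyHull_flat_certificate` of
stmt-FinalStateConjecture-17430).** Given the Choquet-Bruhat–Geroch fact, the Minkowski vacuum Cauchy development of the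
(admissible) trivial datum satisfies `DevHyp` (`ChannelsResolveTameDevelopmentsR.TrivialDatum.minkowski_devHyp`); for every all-orders class with
`1 ≤ Λ 0`, `0 < r₀` the flat end along the time axis is a silent hull element of it (`isSilentHullElement_flatEnd`);
and at that element the conclusion of stub D holds verbatim (`dockReadyHull_conclusion_flatEnd`: (G6) and case B).
[cite: Anderson2004, Def. 1.1] -/
theorem dockReadyHull_flat_certificate : ∀ [Minkowski.vacuumCauchyDevelopment.metric.HasLeviCivita], choquetBruhat_geroch_exists_mghd_cauchy → ∀ (Λ : ℕ → ℝ≥0) (r₀ : ℝ), 1 ≤ ((Λ 0 : ℝ≥0) : ℝ) → 0 < r₀ → DevHyp Minkowski.vacuumCauchyDevelopment ∧ IsSilentHullElement Minkowski.vacuumCauchyDevelopment Λ r₀ (fun n : ℕ ↦ (E4.ofTimeSpace ((n : ℝ) + 1) 0 : E4)) Minkowski.spacetime (EndDatum.mk 0 1 0 Subtype.val (fun x : E4 ↦ x 0) : EndDatum Minkowski.spacetime) (0 : E4) ∧ (IsMinkowski Minkowski.spacetime → EndDatum.horizon (EndDatum.mk 0 1 0 Subtype.val (fun x : E4 ↦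 x 0) : EndDatum Minkowski.spacetime) = ∅) ∧ ∀ [Minkowski.spacetime.metric.HasLeviCivita], (Minkowski.spacetime.metric.IsGloballyHyperbolic Minkowski.spacetime.timeOrientation ∧ Minkowski.spacetime.metric.IsTimelikeGeodesicallyComplete ∧ Minkowski.spacetime.metric.IsNullGeodesicallyComplete) ∨ (∃ (𝓢' : Spacetime.{0} 4) (E' : EndDatum 𝓢') (Λ' : ℕ → ℝ≥0) (r₀' : ℝ) (j : 𝓢'.carrier → Minkowski.spacetime.carrier), IsTameClass E' Λ' r₀' ∧ E'.IsSilent ∧ (∀ [𝓢'.metric.HasLeviCivita], 𝓢'.metric.IsGloballyHyperbolic 𝓢'.timeOrientation ∧ ((𝓢'.blackHoleRegionOfEnd (Set.range E'.far)).Nonempty ∨ (𝓢'.metric.IsTimelikeGeodesicallyComplete ∧ 𝓢'.metric.IsNullGeodesicallyComplete))) ∧ Function.Injective j ∧ PseudoRiemannianMetric.IsLocalIsometry 𝓢'.metric.toPseudoRiemannianMetric Minkowski.spacetime.metric.toPseudoRiemannianMetric j ∧ (∀ (x : 𝓢'.carrier) (v : TangentSpace (𝓡 4) x), 𝓢'.timeOrientation.IsFutureDirected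 v → Minkowski.spacetime.timeOrientation.IsFutureDirected (mfderiv (𝓡 4) (𝓡 4) j x v)) ∧ j '' E'.doc = EndDatum.doc (EndDatum.mk 0 1 0 Subtype.val (fun x : E4 ↦ x 0) : EndDatum Minkowski.spacetime) ∧ (IsMinkowski 𝓢' → IsMinkowski Minkowski.spacetime)) := by
  intro _ hcbg Λ r₀ hΛ hr₀
  exact ⟨ChannelsResolveTameDevelopmentsR.TrivialDatum.minkowski_devHyp hcbg, isSilentHullElement_flatEnd Λ hΛ hr₀,
    dockReadyHull_conclusion_flatEnd.1, dockReadyHull_conclusion_flatEnd.2⟩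

end Summit.FinalStateConjecture.FinalStateConjecture.Theorems.TameLaSalle

end
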